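import Summits.CriticalPhenomena.SAWScalingLimit.Theorems.SAWLoopFugacityFlowAvoidanceLimitTaggiPlaquettes

/-!
# The loop-dressed two-leg function is a sum over self-avoiding paths penalised by their Kesten
patterns — helper of the registered stub `isMassive_above_criticalFugacity_of_pos` (line
`saw-corner-germ`, crux `SAWLoopFugacityFlow.AvoidanceLimit`, stmt-CriticalPhenomena-10649)

For the strictly dilute loop-dressed SAW `Z_{n,0,y}` (tree `DiluteLoopModel ⟨n, 0, y⟩`) with
NONNEGATIVE loop fugacity `n` and edge fugacity `y`:

* `partitionFunction_two_le_sum_paths_sdiff` (any `H ≤ ℤ²`): the dressed path expansion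
  `Z_{n,0,y}(H, Λ; {a} ∆ {b}) ≤ Σ_{γ ∈ pathsIn H Λ a b} y^{|γ|} · Z_{n,0,y}(H, Λ ∖ V(γ); ∅)` — a
  collision-free two-source configuration is its open strand `γ` plus a source-free configuration on
  the vertices OFF `γ` (`DetExpansion.exists_path_of_mem_cfConfigs`, `sdiff_path_mem_cfConfigs`), the
  map `F ↦ (γ, F ∖ γ)` is injective, weights are nonnegative (in fact equality holds; only `≤` is
  used);
* `partitionFunction_sdiff_support_mul_pow_le` (on `ℤ²`): for a self-avoiding path `γ` inside `Λ`,
  `Z(Λ ∖ V(γ); ∅) · (1 + n y⁴)^{J(γ)} ≤ Z(Λ; ∅)`, where `J(γ) = vCount |γ| ω_γ` is the number of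
  occurrences of Kesten's pattern `(V, Q)` (`SAWKestenPatterns.lean`, Madras–Slade Definition 7.2.2) on
  the vertex function `ω_γ(i) = γ(i) - a` of the path: each occurrence at time `k` carries the unit
  square through `γ(k+2), γ(k+3), γ(k+4), γ(k+5)` (`square_plaquette`), all of whose vertices are
  WALK vertices, distinct occurrences are `≥ 12` steps apart (`SAW.Zd.occV_sep_occV`) hence their
  squares are vertex-disjoint (self-avoidance), and the dressing penalty
  `partitionFunction_sdiff_mul_pow_le` applies;
* `twoLegDim_le_sum_paths_penalty` (registered): consequently
  `twoLegDim n 0 y ℤ² Λ a b ≤ Σ_{γ ∈ pathsIn ℤ² Λ a b} y^{|γ|} / (1 + n y⁴)^{J(γ)}` — every Kesten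
  pattern of the walk costs a factor `(1 + n y⁴)⁻¹ < 1` once `n, y > 0`. With Kesten's pattern theorem
  (`SAW.Zd.thm723`: all but exponentially few `N`-step walks have `J ≥ N/q`) this is the mechanism of
  Taggi's strict shift of the critical fugacity.

Sources: L. Taggi, *Shifted critical threshold in the loop O(n) model at arbitrarily small n*,
Electron. Commun. Probab. 23 (2018), proof of Thm 1.1 [Taggi2018]; N. Madras, G. Slade, *The
Self-Avoiding Walk* (1993), §1.2 and Definition 7.2.2 [MadrasSlade1993]. No definitions and no
notations; no statement of the line is asserted here.
-/

noncomputable section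

open Finset Filter Topology
open scoped symmDiff
open Literature.Probability.RandomPlanarGeometry Literature.Probability.LatticeModels
open Summit.CriticalPhenomena.SAWScalingLimit.Theorems.AvoidanceLimit.Anchor

namespace Summit.CriticalPhenomena.SAWScalingLimit.Theorems.AvoidanceLimit.Corner

-- No notations and no auxiliary definitions: the collision-free configurations of `H` in the volume
-- `S` with source set `A` are written `(configs H S A).filter (oscVerts S · = ∅)` throughout.

section PathExpansion

open DiluteLoopModel SimpleGraph DetExpansion

variable {H : SimpleGraph (Site 2)} [H.LocallyFinite]

/-- **The dressed path expansion (inequality).** For `n, y ≥ 0`, `a ≠ b`, on `H ≤ ℤ²`: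
`Z_{n,0,y}(H, S; {a} ∆ {b}) ≤ Σ_{γ ∈ pathsIn H S a b} y^{|γ|} · Z_{n,0,y}(H, S ∖ V(γ); ∅)` — decompose
each collision-free configuration into its open strand `γ` and a source-free collision-free
configuration none of whose edges touches `γ`, i.e. a configuration of the punctured volume
`S ∖ V(γ)` with the same weight (`mem_cfConfigs_sdiff_iff`, `loops_sdiff_eq_of_avoid`); the map
`F ↦ (γ, F ∖ γ)` is injective and all weights are `≥ 0`. [cite: MadrasSlade1993, §1.2] -/
theorem partitionFunction_two_le_sum_paths_sdiff (hH : H ≤ zdGraph 2) {n y : ℝ} (hn : 0 ≤ n)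
    (hy : 0 ≤ y) (S : Finset (Site 2)) {a b : Site 2} (hab : a ≠ b) :
    (⟨n, 0, y⟩ : DiluteLoopModel ℝ).partitionFunction H S ({a} ∆ {b}) ≤
      ∑ p ∈ pathsIn H S a b, y ^ p.length *
        (⟨n, 0, y⟩ : DiluteLoopModel ℝ).partitionFunction H (S \ p.support.toFinset) ∅ := by
  classical
  rw [partitionFunction_dilute_eq_sum]
  set C := ((configs H S ({a} ∆ {b})).filter fun F => oscVerts S F = ∅) with hC
  -- the open strand of each configuration
  have key : ∀ F : {F // F ∈ C}, ∃ p : H.Walk a b, p.IsPath ∧ (∀ z ∈ p.support, z ∈ S) ∧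
      p.edges.toFinset ⊆ F.1 ∧ ∀ e ∈ F.1, e ∉ p.edges.toFinset → ∀ z ∈ p.support, z ∉ e :=
    fun F => exists_path_of_mem_cfConfigs hH _ F.1 a rfl hab F.2
  choose path hpath hS hE havoid using key
  have hav : ∀ F : {F // F ∈ C}, ∀ e ∈ F.1 \ (path F).edges.toFinset, ∀ z ∈ e,
      z ∉ (path F).support.toFinset := by
    intro F e he z hz hzs
    obtain ⟨heF, heP⟩ := mem_sdiff.1 he
    exact havoid F e heF heP z (List.mem_toFinset.1 hzs) hz
  set g : (Σ _ : H.Walk a b, Finset (Sym2 (Site 2))) → ℝ :=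
    fun q => y ^ q.1.length * (y ^ #q.2 * n ^ loops (S \ q.1.support.toFinset) q.2 ∅) with hg
  set φ : {F // F ∈ C} → (Σ _ : H.Walk a b, Finset (Sym2 (Site 2))) :=
    fun F => ⟨path F, F.1 \ (path F).edges.toFinset⟩ with hφ
  have hinj : ∀ F₁ ∈ C.attach, ∀ F₂ ∈ C.attach, φ F₁ = φ F₂ → F₁ = F₂ := by
    intro F₁ _ F₂ _ h
    obtain ⟨h1, h2⟩ := Sigma.mk.inj_iff.1 h
    have h2' := eq_of_heq h2
    apply Subtype.ext
    calc F₁.1 = (path F₁).edges.toFinset ∪ (F₁.1 \ (path F₁).edges.toFinset) :=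
        (union_sdiff_of_subset (hE F₁)).symm
      _ = (path F₂).edges.toFinset ∪ (F₂.1 \ (path F₂).edges.toFinset) := by rw [h2', h1]
      _ = F₂.1 := union_sdiff_of_subset (hE F₂)
  have hweight : ∀ F : {F // F ∈ C}, y ^ #F.1 * n ^ loops S F.1 ∅ = g (φ F) := by
    intro F
    have ha : a ∈ S := hS F a (path F).start_mem_support
    simp only [hg, hφ]
    rw [card_eq_length_add_card_sdiff (hpath F) (hE F),
      loops_eq_loops_sdiff_path hH (hpath F) ha (hE F) (havoid F), loops_sdiff_eq_of_avoid (hav F),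
      pow_add, mul_assoc]
  have himage : C.attach.image φ ⊆ (pathsIn H S a b).sigma fun p =>
      ((configs H (S \ p.support.toFinset) ∅).filter fun F => oscVerts (S \ p.support.toFinset) F = ∅) := by
    rw [image_subset_iff]
    intro F _
    exact mem_sigma.2 ⟨mem_pathsIn.2 ⟨hpath F, hS F⟩,
      (mem_cfConfigs_sdiff_iff hH).2 ⟨sdiff_path_mem_cfConfigs hH F.2 (havoid F), hav F⟩⟩
  calc ∑ F ∈ C, y ^ #F * n ^ loops S F ∅
      = ∑ F ∈ C.attach, y ^ #F.1 * n ^ loops S F.1 ∅ := (sum_attach C _).symm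
    _ = ∑ F ∈ C.attach, g (φ F) := sum_congr rfl fun F _ => hweight F
    _ = ∑ q ∈ C.attach.image φ, g q := (sum_image hinj).symm
    _ ≤ ∑ q ∈ (pathsIn H S a b).sigma (fun p => ((configs H (S \ p.support.toFinset) ∅).filter
          fun F => oscVerts (S \ p.support.toFinset) F = ∅)), g q :=
        sum_le_sum_of_subset_of_nonneg himage fun q _ _ =>
          mul_nonneg (pow_nonneg hy _) (mul_nonneg (pow_nonneg hy _) (pow_nonneg hn _))
    _ = ∑ p ∈ pathsIn H S a b, ∑ R ∈ ((configs H (S \ p.support.toFinset) ∅).filter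
          fun F => oscVerts (S \ p.support.toFinset) F = ∅), g ⟨p, R⟩ := sum_sigma _ _ _
    _ = ∑ p ∈ pathsIn H S a b, y ^ p.length *
          (⟨n, 0, y⟩ : DiluteLoopModel ℝ).partitionFunction H (S \ p.support.toFinset) ∅ := by
        refine sum_congr rfl fun p _ => ?_
        rw [partitionFunction_dilute_eq_sum, mul_sum]

end PathExpansion

section Patterns

open DiluteLoopModel SimpleGraph DetExpansion

/-- **Every Kesten pattern of a self-avoiding path carries a walk-supported plaquette**: for a
self-avoiding path `γ` of `ℤ²` from `a` inside `Λ` and `n, y ≥ 0`,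
`Z_{n,0,y}(ℤ², Λ ∖ V(γ); ∅) · (1 + n y⁴)^{J(γ)} ≤ Z_{n,0,y}(ℤ², Λ; ∅)`, where `J(γ)` is the number of
occurrences of `(V, Q)` on `ω_γ(i) = γ(i) - a` (Madras–Slade Definition 7.2.2): the occurrence at
time `k` gives the unit square through `γ(k+2), …, γ(k+5)` — four WALK vertices, so the square is
vertex-disjoint from every configuration of `Λ ∖ V(γ)` — distinct occurrences are `≥ 12` steps apart
(`SAW.Zd.occV_sep_occV`) so by self-avoidance their squares are pairwise vertex-disjoint, and the
dressing penalty `partitionFunction_sdiff_mul_pow_le` applies with `ℓ = 4`.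
[cite: Taggi2018, proof of Thm 1.1] -/
theorem partitionFunction_sdiff_support_mul_pow_le {n y : ℝ} (hn : 0 ≤ n) (hy : 0 ≤ y)
    {Λ : Finset (Site 2)} {a b : Site 2} {p : (zdGraph 2).Walk a b} (hp : p.IsPath)
    (hΛ : ∀ z ∈ p.support, z ∈ Λ) :
    (⟨n, 0, y⟩ : DiluteLoopModel ℝ).partitionFunction (zdGraph 2) (Λ \ p.support.toFinset) ∅ *
        (1 + n * y ^ 4) ^ SAW.Zd.vCount p.length (fun i => p.getVert i - a) ≤
      (⟨n, 0, y⟩ : DiluteLoopModel ℝ).partitionFunction (zdGraph 2) Λ ∅ := by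
  classical
  set ω : ℕ → Site 2 := fun i => p.getVert i - a with hω
  -- an occurrence of `(V, Q)` at time `k`: the walk follows `V` from `γ(k)`
  have hocc : ∀ k ∈ SAW.Zd.vSites p.length ω, k + 11 ≤ p.length ∧
      ∀ t ≤ 11, p.getVert (k + t) = p.getVert k + SAW.Zd.vPt t := by
    intro k hk
    obtain ⟨hk11, hseg, -⟩ := SAW.Zd.mem_vSites.1 hk
    refine ⟨hk11, fun t ht => ?_⟩
    have h := hseg t ht
    simp only [hω] at h
    rwa [sub_add_eq_add_sub, sub_left_inj] at h
  -- the plaquette family: the square through `γ(k+2), …, γ(k+5)`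
  set π : ℕ → Finset (Sym2 (Site 2)) := fun k =>
    {s(p.getVert k + SAW.Zd.vPt 2, p.getVert k + SAW.Zd.vPt 5),
      s(p.getVert k + SAW.Zd.vPt 2, p.getVert k + SAW.Zd.vPt 3),
      s(p.getVert k + SAW.Zd.vPt 3, p.getVert k + SAW.Zd.vPt 4),
      s(p.getVert k + SAW.Zd.vPt 4, p.getVert k + SAW.Zd.vPt 5)} with hπ
  have hsq : ∀ k ∈ SAW.Zd.vSites p.length ω,
      π k ∈ ((configs (zdGraph 2) Λ ∅).filter fun F => oscVerts Λ F = ∅) ∧ loops Λ (π k) ∅ = 1 ∧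
        #(π k) = 4 ∧ ∀ e ∈ π k, ∀ z ∈ e, ∃ t : ℕ, 2 ≤ t ∧ t ≤ 5 ∧ z = p.getVert (k + t) := by
    intro k hk
    obtain ⟨-, hseg⟩ := hocc k hk
    have hadj : ∀ t : ℕ, t < 11 →
        (zdGraph 2).Adj (p.getVert k + SAW.Zd.vPt t) (p.getVert k + SAW.Zd.vPt (t + 1)) :=
      fun t ht => SAW.Zd.adj_vPt _ ht
    have h25 : (zdGraph 2).Adj (p.getVert k + SAW.Zd.vPt 2) (p.getVert k + SAW.Zd.vPt 5) := by
      unfold SAW.Zd.vPt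
      exact SAW.Zd.adj_add_mk2 _ (by simp [SAW.Zd.vCoord])
    have hvert : ∀ t : ℕ, 2 ≤ t → t ≤ 5 → p.getVert k + SAW.Zd.vPt t ∈ Λ := fun t _ ht5 => by
      rw [← hseg t (by omega)]
      exact hΛ _ (p.getVert_mem_support _)
    obtain ⟨h1, h2, h3, h4⟩ := square_plaquette (H := zdGraph 2) le_rfl (Λ := Λ) (p.getVert k) rfl
      (hadj 2 (by norm_num)) (hadj 3 (by norm_num)) (hadj 4 (by norm_num)) h25 hvert
    refine ⟨h1, h2, h3, fun e he z hz => ?_⟩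
    obtain ⟨t, ht2, ht5, rfl⟩ := h4 e he z hz
    exact ⟨t, ht2, ht5, (hseg t (by omega)).symm⟩
  have hπ' : ∀ k ∈ SAW.Zd.vSites p.length ω,
      π k ∈ ((configs (zdGraph 2) Λ ∅).filter fun F => oscVerts Λ F = ∅) ∧ loops Λ (π k) ∅ = 1 ∧
        #(π k) = 4 ∧ ∀ e ∈ π k, ∀ z ∈ e, z ∈ p.support.toFinset := by
    intro k hk
    obtain ⟨h1, h2, h3, h4⟩ := hsq k hk
    refine ⟨h1, h2, h3, fun e he z hz => ?_⟩
    obtain ⟨t, -, -, rfl⟩ := h4 e he z hz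
    exact List.mem_toFinset.2 (p.getVert_mem_support _)
  -- distinct occurrences carry vertex-disjoint squares
  have hdj : ∀ k ∈ SAW.Zd.vSites p.length ω, ∀ k' ∈ SAW.Zd.vSites p.length ω, k ≠ k' →
      ∀ z : Site 2, ∀ e ∈ π k, ∀ e' ∈ π k', z ∈ e → z ∉ e' := by
    intro k hk k' hk' hkk' z e he e' he' hze hze'
    have hk11 := (hocc k hk).1
    have hk11' := (hocc k' hk').1
    have hsep := SAW.Zd.occV_sep_occV (SAW.Zd.mem_vSites.1 hk) (SAW.Zd.mem_vSites.1 hk') hkk'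
    obtain ⟨t, ht2, ht5, rfl⟩ := (hsq k hk).2.2.2 e he z hze
    obtain ⟨t', ht2', ht5', h⟩ := (hsq k' hk').2.2.2 e' he' _ hze'
    have := hp.getVert_injOn (by simp only [Set.mem_setOf_eq]; omega)
      (by simp only [Set.mem_setOf_eq]; omega) h
    omega
  exact partitionFunction_sdiff_mul_pow_le (zdGraph 2) le_rfl n y hn hy 4 Λ p.support.toFinset
    (SAW.Zd.vSites p.length ω) π hπ' hdj

/-- **Registered helper · the two-leg function as a pattern-penalised path sum.** For `n, y ≥ 0` and
`a ≠ b`, on `ℤ²`: `twoLegDim n 0 y ℤ² Λ a b ≤ Σ_{γ ∈ pathsIn ℤ² Λ a b} y^{|γ|} / (1 + n y⁴)^{J(γ)}`,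
`J(γ) = SAW.Zd.vCount |γ| (i ↦ γ(i) - a)` the number of occurrences of Kesten's pattern `(V, Q)` on
the walk (divide the dressed path expansion by `Z(Λ; ∅) ≥ 1` and use the plaquette penalty path by
path). At `n = 0` this is the equality `twoLegDim 0 0 y = Σ_γ y^{|γ|}`; for `n > 0` every pattern
costs a factor `< 1`. [cite: Taggi2018, proof of Thm 1.1] -/
theorem twoLegDim_le_sum_paths_penalty :
    ∀ (n y : ℝ), 0 ≤ n → 0 ≤ y → ∀ (Λ : Finset (Site 2)) (a b : Site 2), a ≠ b →
      twoLegDim n 0 y (zdGraph 2) Λ a b ≤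
        ∑ p ∈ DiluteLoopModel.pathsIn (zdGraph 2) Λ a b,
          y ^ p.length / (1 + n * y ^ 4) ^ SAW.Zd.vCount p.length (fun i => p.getVert i - a) := by
  intro n y hn hy Λ a b hab
  have hZ : 0 < (⟨n, 0, y⟩ : DiluteLoopModel ℝ).partitionFunction (zdGraph 2) Λ ∅ :=
    partitionFunction_empty_pos (L := ⟨n, 0, y⟩) hn le_rfl hy Λ
  rw [twoLegDim_dimerFugacity_zero, twoLeg, div_le_iff₀ hZ, sum_mul]
  refine (partitionFunction_two_le_sum_paths_sdiff le_rfl hn hy Λ hab).trans (sum_le_sum fun p hp => ?_)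
  obtain ⟨hpp, hpΛ⟩ := mem_pathsIn.1 hp
  have hβ : 0 < (1 + n * y ^ 4) ^ SAW.Zd.vCount p.length (fun i => p.getVert i - a) :=
    pow_pos (by positivity) _
  rw [div_mul_eq_mul_div, le_div_iff₀ hβ, mul_assoc]
  exact mul_le_mul_of_nonneg_left (partitionFunction_sdiff_support_mul_pow_le hn hy hpp hpΛ)
    (pow_nonneg hy _)

end Patterns

end Summit.CriticalPhenomena.SAWScalingLimit.Theorems.AvoidanceLimit.Corner

end
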